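import Literature.Probability.LatticeModels.InterfaceSLETightness
import HarnessLib

/-!
# Critical Ising interfaces: subsequential limits are carried by curves from `a`

Topic `Literature/Probability/LatticeModels` (family `crit-ising`); theorems only. A small
support lemma of the decomposition of CDHKS Theorem 1 (Chelkak–Duminil-Copin–Hongler–
Kemppainen–Smirnov, C. R. Math. 352 (2014)): every weak subsequential limit `ν` of the laws
`spinInterfaceLaw D E sel δ` of the critical spin-Ising Dobrushin interfaces of admissible
discretisations `(Ω_δ; a_δ, b_δ) → (D; a, b)` gives full mass to curve classes **starting at
`a`** (`ae_source_eq_of_tendsto_spinInterfaceLaw`). This is the clause "`ν`-a.e. `c.source = a`"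
of the canonical (moment-free) identification hypotheses of `InterfaceSLELocal.lean` /
`InterfaceSLELimitData.lean` (it makes the Loewner transform `drivingFunction φ` vanish at time
`0`, `drivingFunction_apply_zero`), discharged here from the lattice side:

* `IsDobrushinInterface.exists_cons_map_dualMedialPoint` — the polygon of a Dobrushin interface
  runs from the midpoint of one `A`–`B` boundary edge to the midpoint of the other
  (`IsDobrushinInterfaceWalk.head_mem/getLast_mem/head_ne_getLast`, `dualMedialPoint_eq_of_adj`,
  `IsZdAdmissible.ncard_zdABEdges_eq_two`), so the set of discrete marked points
  `medialPoint δ '' zdABEdges` is exactly the set of its two end points;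
* `dist_source_spinInterfaceCurve_lt` — if that set is within Hausdorff distance `ε ≤ |a - b|/2`
  of `{a, b}`, the re-oriented interface curve (`orientChord`: keep the list if its head is closer
  to `a`, reverse it otherwise) starts within `ε` of `a`;
* `ae_source_eq_of_tendsto_spinInterfaceLaw` — the limit statement, through the bounded
  continuous test function `c ↦ min 1 (dist c.source a)` (no portmanteau theorem is needed):
  its integral against `spinInterfaceLaw D E sel (u n)` is eventually `≤ ε`
  (`IsDiscretisation.tendsto_zdABEdges`, `eventually_isZdAdmissible`, existence of Dobrushin
  interfaces `exists_isDobrushinInterface_holds` so that the selection rule is constrained on every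
  configuration), hence `0` in the limit.

No definition and no named fact is introduced.

## References

* D. Chelkak, H. Duminil-Copin, C. Hongler, A. Kemppainen, S. Smirnov, *Convergence of Ising
  interfaces to Schramm's SLE curves*, C. R. Math. Acad. Sci. Paris 352 (2014) 157–161, §1
  (discrete domains `(Ω_δ; a_δ, b_δ)` approximating `(Ω; a, b)`, interfaces from `a_δ` to `b_δ`).
* A. Kemppainen, S. Smirnov, *Random curves, scaling limits and Loewner evolutions*, Ann.
  Probab. 45 (2017), §1.2 (the normalisation `γ̃(0) = 0` of the driving process).
-/

noncomputable section

open MeasureTheory Filter Topology Set Metric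
open scoped ENNReal NNReal BoundedContinuousFunction
open Literature.Probability.LatticeModels Literature.Probability.Percolation
open Literature.Probability.RandomPlanarGeometry (CurveClass DobrushinDomain)

namespace Literature.Probability.LatticeModels

/-! ### End points of the interface polygon -/

/-- The polygon vertex attached to a dual dart of the face graph is the medial point of the
crossed primal edge: `dualMedialPoint δ d.edge = medialPoint δ (dualDartEdge d.fst d.snd)`.
[cite: CDHKSCRAS2014, §1] -/
theorem dualMedialPoint_dart_edge (δ : ℝ) (d : (zdGraph 2).Dart) :
    dualMedialPoint δ d.edge = medialPoint δ (dualDartEdge d.fst d.snd) := by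
  have h : d.edge = s(d.fst, d.snd) := rfl
  rw [h, dualMedialPoint_eq_of_adj δ d.adj, dualDartEdge, medialPoint_mk]

/-- **The polygon of a Dobrushin interface runs between the two discrete marked points.** For a
Dobrushin interface `γ` of admissible data `E`, the list of polygon vertices
`γ.map (dualMedialPoint δ)` is nonempty, and its first and last points are the medial points of
the two (distinct) `A`–`B` boundary edges, so that
`medialPoint δ '' E.zdABEdges = {first point, last point}`. [cite: CDHKSCRAS2014, §1] -/
theorem IsDobrushinInterface.exists_cons_map_dualMedialPoint {E : DiscreteDobrushin}
    (hE : E.IsZdAdmissible) {σ : SpinConfig (Site 2)} {γ : List (Sym2 (Site 2))}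
    (hγ : IsDobrushinInterface E σ γ) (δ : ℝ) :
    ∃ (z : ℂ) (l : List ℂ), γ.map (dualMedialPoint δ) = z :: l ∧
      medialPoint δ '' E.zdABEdges = {z, (z :: l).getLast (List.cons_ne_nil z l)} := by
  obtain ⟨f, g, w, hw, rfl⟩ := hγ
  have hne := hw.darts_ne_nil
  -- the polygon vertices along the darts
  have hmap : w.edges.map (dualMedialPoint δ) =
      w.darts.map (fun d ↦ medialPoint δ (dualDartEdge d.fst d.snd)) := by
    rw [SimpleGraph.Walk.edges, List.map_map]
    refine List.map_congr_left fun d _ ↦ ?_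
    exact dualMedialPoint_dart_edge δ d
  obtain ⟨d₀, rest, hd⟩ := List.exists_cons_of_ne_nil hne
  set e₀ := dualDartEdge (w.darts.head hne).fst (w.darts.head hne).snd with he₀
  set e₁ := dualDartEdge (w.darts.getLast hne).fst (w.darts.getLast hne).snd with he₁
  have h0 : e₀ ∈ E.zdABEdges := hw.head_mem
  have h1 : e₁ ∈ E.zdABEdges := hw.getLast_mem
  have h01 : e₀ ≠ e₁ := hw.head_ne_getLast
  -- `zdABEdges = {e₀, e₁}`
  have hset : E.zdABEdges = {e₀, e₁} := by
    obtain ⟨x, y, hxy, hxy'⟩ := Set.ncard_eq_two.1 hE.ncard_zdABEdges_eq_two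
    rw [hxy'] at h0 h1 ⊢
    rcases h0 with rfl | rfl <;> rcases h1 with h1 | h1
    · exact absurd h1.symm h01
    · rw [Set.mem_singleton_iff] at h1; rw [h1]
    · rw [h1, Set.pair_comm]
    · rw [Set.mem_singleton_iff] at h1; exact absurd h1.symm h01
  refine ⟨medialPoint δ e₀, rest.map (fun d ↦ medialPoint δ (dualDartEdge d.fst d.snd)), ?_, ?_⟩
  · rw [hmap, hd, List.map_cons]
    have : w.darts.head hne = d₀ := by simp [hd]
    rw [he₀, this]
  · rw [hset, Set.image_pair]
    congr 1
    have hlast : (medialPoint δ e₀ :: rest.map (fun d ↦ medialPoint δ (dualDartEdge d.fst d.snd))).getLast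
        (List.cons_ne_nil _ _) = medialPoint δ e₁ := by
      have h2 : (medialPoint δ e₀ :: rest.map (fun d ↦ medialPoint δ (dualDartEdge d.fst d.snd))) =
          (d₀ :: rest).map (fun d ↦ medialPoint δ (dualDartEdge d.fst d.snd)) := by
        rw [List.map_cons, he₀]
        have : w.darts.head hne = d₀ := by simp [hd]
        rw [this]
      have h3 : w.darts.getLast hne = (d₀ :: rest).getLast (List.cons_ne_nil _ _) := by simp [hd]
      rw [he₁, h3]
      simp only [h2, List.getLast_map]
    rw [hlast]

/-! ### Orientation: the re-oriented curve starts near `a` -/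

/-- The source of the class of a nonempty polyline is its first vertex. [folklore] -/
theorem source_mk_polyline_cons (z : ℂ) (l : List ℂ) :
    (CurveClass.mk ⟨polyline (z :: l)⟩ : CurveClass ℂ).source = z := by
  rw [RandomPlanarGeometry.CurveClass.source_mk]
  exact polyline_apply_zero z l

/-- **The re-oriented polygon starts within `ε` of `a`.** If the first and last vertices `z`,
`z'` of a nonempty vertex list satisfy: `z` is within `ε` of `a` or of `b`, and one of `z`, `z'`
is within `ε` of `a` (both hold when "`{z, z'}` is within Hausdorff distance `ε` of `{a, b}`"),
and `2ε ≤ |a - b|`, then the curve class of the polyline re-oriented by `orientChord D` (keep the list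
if its head is at least as close to `a` as to `b`, reverse it otherwise) starts within `ε` of
`a = D.pt 0`. [cite: CDHKSCRAS2014, §1] -/
theorem dist_source_mk_polyline_orientChord_lt (D : DobrushinDomain) {z : ℂ} {l : List ℂ} {ε : ℝ}
    (hε : 2 * ε ≤ dist (D.pt 0) (D.pt 1))
    (hz : dist z (D.pt 0) < ε ∨ dist z (D.pt 1) < ε)
    (ha : dist z (D.pt 0) < ε ∨ dist ((z :: l).getLast (List.cons_ne_nil z l)) (D.pt 0) < ε) :
    dist (CurveClass.mk ⟨polyline (orientChord D (z :: l))⟩ : CurveClass ℂ).source (D.pt 0) < ε := by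
  by_cases hle : dist z (D.pt 0) ≤ dist z (D.pt 1)
  · rw [orientChord_of_le D l hle, source_mk_polyline_cons]
    rcases hz with h | h
    · exact h
    · exact hle.trans_lt h
  · have hrev : orientChord D (z :: l) = (z :: l).reverse := by
      simp [orientChord, hle]
    rw [hrev]
    obtain ⟨z₁, l₁, h₁⟩ := List.exists_cons_of_ne_nil (List.reverse_ne_nil_iff.2 (List.cons_ne_nil z l))
    have hz₁ : z₁ = (z :: l).getLast (List.cons_ne_nil z l) := by
      have : (z :: l).reverse.head (List.reverse_ne_nil_iff.2 (List.cons_ne_nil z l)) = z₁ := by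
        simp [h₁]
      rw [← this, List.head_reverse]
    rw [h₁, source_mk_polyline_cons, hz₁]
    rcases ha with h | h
    · -- `z` is near `a` but closer to `b`: impossible when `2ε ≤ |a - b|`
      exfalso
      rw [not_le] at hle
      have := dist_triangle_left (D.pt 0) (D.pt 1) z
      linarith
    · exact h

/-- **The selected interface curve starts within `ε` of `a`** when the data are admissible and
the discrete marked points are within Hausdorff distance `ε` (`2ε ≤ |a - b|`) of `{a, b}`: by
`IsDobrushinInterface.exists_cons_map_dualMedialPoint` the set of discrete marked points is the
set of end points of the polygon, and `dist_source_mk_polyline_orientChord_lt` applies.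
[cite: CDHKSCRAS2014, §1] -/
theorem dist_source_spinInterfaceCurve_lt (D : DobrushinDomain) {E : DiscreteDobrushin}
    (hE : E.IsZdAdmissible) {σ : SpinConfig (Site 2)} {γ : List (Sym2 (Site 2))}
    (hγ : IsDobrushinInterface E σ γ) {δ ε : ℝ} (hε0 : 0 < ε)
    (hε : 2 * ε ≤ dist (D.pt 0) (D.pt 1))
    (hH : hausdorffEDist (medialPoint δ '' E.zdABEdges) {D.pt 0, D.pt 1} < ENNReal.ofReal ε) :
    dist (spinInterfaceCurve D δ γ).source (D.pt 0) < ε := by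
  obtain ⟨z, l, hzl, hset⟩ := hγ.exists_cons_map_dualMedialPoint hE δ
  unfold spinInterfaceCurve
  rw [hzl]
  -- translate the Hausdorff bound
  have hnear : ∀ p ∈ ({z, (z :: l).getLast (List.cons_ne_nil z l)} : Set ℂ),
      dist p (D.pt 0) < ε ∨ dist p (D.pt 1) < ε := by
    intro p hp
    rw [← hset] at hp
    obtain ⟨q, hq, hpq⟩ := exists_edist_lt_of_hausdorffEDist_lt hp hH
    rw [edist_dist, ENNReal.ofReal_lt_ofReal_iff hε0] at hpq
    rcases hq with rfl | rfl
    · exact Or.inl hpq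
    · exact Or.inr hpq
  have ha : dist z (D.pt 0) < ε ∨ dist ((z :: l).getLast (List.cons_ne_nil z l)) (D.pt 0) < ε := by
    have hH' : hausdorffEDist {D.pt 0, D.pt 1} (medialPoint δ '' E.zdABEdges) < ENNReal.ofReal ε := by
      rwa [hausdorffEDist_comm]
    obtain ⟨p, hp, hpq⟩ := exists_edist_lt_of_hausdorffEDist_lt (Set.mem_insert _ _) hH'
    rw [edist_dist, ENNReal.ofReal_lt_ofReal_iff hε0, dist_comm] at hpq
    rw [hset] at hp
    rcases hp with rfl | rfl
    · exact Or.inl hpq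
    · exact Or.inr hpq
  exact dist_source_mk_polyline_orientChord_lt D hε (hnear z (Set.mem_insert _ _)) ha

/-! ### The limit statement -/

/-- **Subsequential limits of the spin interface laws are carried by curves from `a`.** Let `E` be
admissible discretisations of the Dobrushin domain `(D; a, b)` (`IsDiscretisation`), `sel δ`
interface-selection rules, `u n → 0⁺` meshes and `ν` a finite measure on the curve space such
that `∫ f d(spinInterfaceLaw D E sel (u n)) → ∫ f dν` for every bounded continuous `f`. Then
`ν`-a.e. curve class starts at `a = D.pt 0`. Proof: the bounded continuous function
`g c = min 1 (dist c.source a) ≥ 0` has `∫ g d(spinInterfaceLaw … (u n)) ≤ ε` for all large `n`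
(every interface curve of an admissible discretisation at a mesh where the discrete marked points
are `ε`-close to `{a, b}` starts within `ε` of `a`, `dist_source_spinInterfaceCurve_lt`; every
configuration has a Dobrushin interface, `exists_isDobrushinInterface_holds`), so `∫ g dν = 0`.
[cite: CDHKSCRAS2014, §1] -/
theorem ae_source_eq_of_tendsto_spinInterfaceLaw {D : DobrushinDomain} {E : ℝ → DiscreteDobrushin}
    (hE : IsDiscretisation D E) {sel : ℝ → SpinConfig (Site 2) → List (Sym2 (Site 2))}
    (hsel : ∀ δ, IsInterfaceSelection (E δ) (sel δ)) {u : ℕ → ℝ} (hu : Tendsto u atTop (𝓝[>] 0))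
    {ν : Measure (CurveClass ℂ)} [IsFiniteMeasure ν]
    (hlim : ∀ f : CurveClass ℂ →ᵇ ℝ,
      Tendsto (fun n => ∫ c, f c ∂spinInterfaceLaw D E sel (u n)) atTop (𝓝 (∫ c, f c ∂ν))) :
    ∀ᵐ c ∂ν, c.source = D.pt 0 := by
  -- the test function
  set g : CurveClass ℂ →ᵇ ℝ := BoundedContinuousFunction.mkOfBound
    ⟨fun c ↦ min 1 (dist c.source (D.pt 0)),
      (continuous_const.min (RandomPlanarGeometry.CurveClass.continuous_source.dist continuous_const))⟩
    1 (fun c c' ↦ by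
      simp only [ContinuousMap.coe_mk, Real.dist_eq]
      have h1 : 0 ≤ min 1 (dist c.source (D.pt 0)) := le_min zero_le_one dist_nonneg
      have h2 : 0 ≤ min 1 (dist c'.source (D.pt 0)) := le_min zero_le_one dist_nonneg
      have h3 : min 1 (dist c.source (D.pt 0)) ≤ 1 := min_le_left _ _
      have h4 : min 1 (dist c'.source (D.pt 0)) ≤ 1 := min_le_left _ _
      rw [abs_le]; constructor <;> linarith) with hg
  have hg_apply : ∀ c, g c = min 1 (dist c.source (D.pt 0)) := fun c ↦ rfl
  have hg0 : ∀ c, 0 ≤ g c := fun c ↦ by rw [hg_apply]; exact le_min zero_le_one dist_nonneg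
  -- `∫ g dν ≤ ε` for every small `ε > 0`
  have hab : 0 < dist (D.pt 0) (D.pt 1) :=
    dist_pos.2 fun h ↦ absurd (D.pt_injective h) (by decide)
  have key : ∀ ε : ℝ, 0 < ε → 2 * ε ≤ dist (D.pt 0) (D.pt 1) → ∫ c, g c ∂ν ≤ ε := by
    intro ε hε hε2
    -- eventually (in the mesh) the three lattice conditions hold
    have hev : ∀ᶠ n in atTop, 0 < u n ∧ (E (u n)).IsZdAdmissible ∧
        hausdorffEDist (medialPoint (u n) '' (E (u n)).zdABEdges) {D.pt 0, D.pt 1} <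
          ENNReal.ofReal ε := by
      have h1 : ∀ᶠ δ in 𝓝[>] (0 : ℝ), 0 < δ := eventually_mem_nhdsWithin
      have h2 := hE.eventually_isZdAdmissible
      have h3 : ∀ᶠ δ in 𝓝[>] (0 : ℝ),
          hausdorffEDist (medialPoint δ '' (E δ).zdABEdges) {D.pt 0, D.pt 1} < ENNReal.ofReal ε :=
        hE.tendsto_zdABEdges (Iio_mem_nhds (ENNReal.ofReal_pos.2 hε))
      exact hu.eventually (h1.and (h2.and h3))
    have hbound : ∀ᶠ n in atTop, ∫ c, g c ∂spinInterfaceLaw D E sel (u n) ≤ ε := by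
      filter_upwards [hev] with n hn
      obtain ⟨hδ, hadm, hH⟩ := hn
      -- every interface curve at this mesh starts within `ε` of `a`
      have hall : ∀ σ, g (spinInterfaceCurve D (u n) (sel (u n) σ)) ≤ ε := by
        intro σ
        have hγ : IsDobrushinInterface (E (u n)) σ (sel (u n) σ) :=
          hsel (u n) σ (exists_isDobrushinInterface_holds (E (u n)) hadm σ)
        rw [hg_apply]
        exact (min_le_right _ _).trans
          (dist_source_spinInterfaceCurve_lt D hadm hγ hε hε2 hH).le
      unfold spinInterfaceLaw
      rw [integral_map (aemeasurable_isingZdDobrushinMeasure _ _ _) g.continuous.aestronglyMeasurable]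
      calc ∫ σ, g (spinInterfaceCurve D (u n) (sel (u n) σ)) ∂isingZdDobrushinMeasure (E (u n)) criticalBetaTwo
          ≤ ∫ _, ε ∂isingZdDobrushinMeasure (E (u n)) criticalBetaTwo := by
            refine integral_mono_of_nonneg (ae_of_all _ fun σ ↦ hg0 _) (integrable_const ε)
              (ae_of_all _ fun σ ↦ hall σ)
        _ = ε := by simp
    exact le_of_tendsto (hlim g) hbound
  -- hence `∫ g dν ≤ 0`, so `g = 0` a.e.
  have hint0 : ∫ c, g c ∂ν = 0 := by
    refine le_antisymm ?_ (integral_nonneg hg0)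
    refine le_of_forall_pos_le_add fun ε hε ↦ ?_
    rw [zero_add]
    set ε' : ℝ := min ε (dist (D.pt 0) (D.pt 1) / 2) with hε'
    have hε'0 : 0 < ε' := lt_min hε (by positivity)
    have hε'2 : 2 * ε' ≤ dist (D.pt 0) (D.pt 1) := by
      have := min_le_right ε (dist (D.pt 0) (D.pt 1) / 2)
      linarith
    exact (key ε' hε'0 hε'2).trans (min_le_left _ _)
  have hgi : Integrable (fun c ↦ g c) ν := g.integrable ν
  have hae := (integral_eq_zero_iff_of_nonneg (fun c ↦ hg0 c) hgi).1 hint0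
  filter_upwards [hae] with c hc
  have hc' : min 1 (dist c.source (D.pt 0)) = 0 := hc
  rcases min_eq_iff.1 hc' with ⟨h1, -⟩ | ⟨h2, -⟩
  · exact absurd h1 one_ne_zero
  · exact dist_eq_zero.1 h2

end Literature.Probability.LatticeModels
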